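import Summits.QuantumFields.YangMills.Theses.ConvexGribovBody
import Literature.MathematicalPhysics.QuantumFieldTheory.UnevenAxialBlocking
import Literature.MathematicalPhysics.QuantumFieldTheory.LatticeGaugeProofs
import Literature.MathematicalPhysics.QuantumFieldTheory.BalabanBlockSpecification
import Literature.MathematicalPhysics.QuantumLattice.BalabanBlockAverage

/-!
# Crux `BrascampLiebVacuum` (stmt-QuantumFields-8779), line `per-scale-brascamp-lieb` — stub `stub_bavgMeasurable`

The unprojected covariant matrix block averages are Borel measurable.
-/

open scoped BigOperators Topology Matrix
open Filter MeasureTheory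
open Literature.MathematicalPhysics.QuantumFieldTheory
open Literature.MathematicalPhysics.QuantumLattice (transport pathEnd)

noncomputable section

namespace Summit.QuantumFields.YangMills.Theorems.BrascampLiebVacuum

/-- **Stub (MATHEMATICS — the block averages are Borel measurable).** For every scale `2^j` the
unprojected covariant matrix block average `bavg` of the 4d field (finite sums of products of
`r.ρ` of parallel transporters) is measurable from the product σ-algebra of the links to the product
σ-algebra of the matrix entries (it is continuous; `G` is second countable through `r`). [folklore] -/
theorem stub_bavgMeasurable :
    ∀ (G : Type) [Group G] [TopologicalSpace G] [IsTopologicalGroup G] [CompactSpace G]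
      [MeasurableSpace G] [BorelSpace G] (r : LatticeRep G) (S j : ℕ),
      let T : ℕ := (2 * S + 1) / 2 ^ j
      let taxi : (Fin 4 → Fin (2 ^ j)) → List (Fin 4) := fun w =>
        ((List.finRange 4).map fun i => List.replicate (w i).val i).flatten
      let bavg : GaugeConfig 4 (2 * S + 1) G → Edge 4 T → Fin r.N → Fin r.N → ℂ := fun U e a b =>
        (((2 ^ j) ^ 4 : ℕ) : ℂ)⁻¹ *
          ∑ w : Fin 4 → Fin (2 ^ j),
            r.ρ (transport U (unevenCorner (2 ^ j) (2 * S + 1) T e.1) (taxi w) *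
                transport U (pathEnd (unevenCorner (2 ^ j) (2 * S + 1) T e.1) (taxi w))
                  (List.replicate (unevenLen (2 ^ j) (2 * S + 1) T e.1 e.2) e.2) *
                (transport U (unevenCorner (2 ^ j) (2 * S + 1) T (e.1.shift e.2)) (taxi w))⁻¹) a b
      Measurable bavg := by
  intro G _ _ _ _ _ _ r S j
  dsimp only
  haveI := r.secondCountableTopology
  refine measurable_pi_lambda _ fun e => measurable_pi_lambda _ fun a =>
    measurable_pi_lambda _ fun b => Continuous.measurable ?_
  refine continuous_const.mul (continuous_finsetSum _ fun w _ => ?_)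
  exact (continuous_apply b).comp ((continuous_apply a).comp (r.continuous.comp
    (((Literature.MathematicalPhysics.QuantumLattice.continuous_transport_config _ _).mul
      (Literature.MathematicalPhysics.QuantumLattice.continuous_transport_config _ _)).mul
      (Literature.MathematicalPhysics.QuantumLattice.continuous_transport_config _ _).inv)))


end Summit.QuantumFields.YangMills.Theorems.BrascampLiebVacuum

end
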